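import Mathlib
import Summits.Ventures.PercRepro2.TypedA3PathRootEdgeB
import Summits.Ventures.PercRepro2.TypedRootMonoOPath

/-!
# The mirrors at `a₂` of night-3 g18's root-edge theorems (blind cell PercRepro2, 2026-08-28;
`proofs/NIGHT3-CERT.md` §27.12–27.13)

Every typed base is symmetric in the roots (`SwapRoots.typedCount_swap_roots`), so each theorem
about a new root edge at `a₁` has a twin at `a₂`: the inert root edge beside a type-2 path
`a₂ – a₃ – o` / `a₂ – a₃ – b` (`typedCount_root_edge_of_a3_path'`, `…_b'`) and (ROOT-MONO) at `a₂`
beside a type-2 path `a₂ – b – o` / `a₂ – o – b` (`rootMonoO_of_b_path'`, `rootMonoB_of_o_path'`).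
Own work; standard axioms.
-/

namespace Summit.Ventures.PercRepro2

open UnionCluster

namespace CovForm

namespace Triangle

section Mirrors

open Classical

variable {V : Type*} {E : Type*} [Fintype E] [DecidableEq E] {R : Type*} [Field R]
  [LinearOrder R] [IsStrictOrderedRing R]
variable (ends : E → Sym2 V) (o a₁ a₂ a₃ b : V)

/-- The mirror of `typedCount_root_edge_of_a3_path` at `a₂`. -/
theorem typedCount_root_edge_of_a3_path' {e f g : E} (he : ends e = s(a₂, o))
    (hf : ends f = s(a₂, a₃)) (hg : ends g = s(o, a₃)) (F : Finset E) (heF : e ∉ F) (hfF : f ∈ F)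
    (hgF : g ∈ F) (z : Config E) (hze : z e = false) (τ : E → ℕ)
    (hτ : ∀ e' ∈ F, τ e' = 1 ∨ τ e' = 2) (hτf : τ f = 2) (hτg : τ g = 2) :
    typedCount (insert e F) z (Function.update τ e 1)
        (K3 ends o a₁ a₂ a₃ b : Config E → Config E → Config E → R) =
      typedCount F z τ (K3 ends o a₁ a₂ a₃ b) := by
  rw [← SwapRoots.typedCount_swap_roots ends o a₁ a₂ a₃ b,
    ← SwapRoots.typedCount_swap_roots ends o a₁ a₂ a₃ b F]
  exact typedCount_root_edge_of_a3_path ends o a₂ a₁ a₃ b he hf hg F heF hfF hgF z hze τ hτ hτf hτg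

/-- The mirror of `typedCount_root_edge_of_a3_path_b` at `a₂`. -/
theorem typedCount_root_edge_of_a3_path_b' {e f g : E} (he : ends e = s(a₂, b))
    (hf : ends f = s(a₂, a₃)) (hg : ends g = s(b, a₃)) (F : Finset E) (heF : e ∉ F) (hfF : f ∈ F)
    (hgF : g ∈ F) (z : Config E) (hze : z e = false) (τ : E → ℕ)
    (hτ : ∀ e' ∈ F, τ e' = 1 ∨ τ e' = 2) (hτf : τ f = 2) (hτg : τ g = 2) :
    typedCount (insert e F) z (Function.update τ e 1)
        (K3 ends o a₁ a₂ a₃ b : Config E → Config E → Config E → R) =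
      typedCount F z τ (K3 ends o a₁ a₂ a₃ b) := by
  rw [← SwapRoots.typedCount_swap_roots ends o a₁ a₂ a₃ b,
    ← SwapRoots.typedCount_swap_roots ends o a₁ a₂ a₃ b F]
  exact typedCount_root_edge_of_a3_path_b ends o a₂ a₁ a₃ b he hf hg F heF hfF hgF z hze τ hτ hτf
    hτg

/-- The mirror of `rootMonoO_of_b_path` at `a₂`: (ROOT-MONO-o) at the root `a₂` beside a type-2 path
`a₂ – b – o`. -/
theorem rootMonoO_of_b_path' {e f g : E} (he : ends e = s(a₂, o)) (hf : ends f = s(a₂, b))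
    (hg : ends g = s(o, b)) (F : Finset E) (heF : e ∉ F) (hfF : f ∈ F) (hgF : g ∈ F)
    (z : Config E) (hze : z e = false) (τ : E → ℕ) (hτ : ∀ e' ∈ F, τ e' = 1 ∨ τ e' = 2)
    (hτf : τ f = 2) (hτg : τ g = 2) :
    typedCount F z τ (K3 ends o a₁ a₂ a₃ b : Config E → Config E → Config E → R) ≤
      typedCount (insert e F) z (Function.update τ e 1) (K3 ends o a₁ a₂ a₃ b) := by
  rw [← SwapRoots.typedCount_swap_roots ends o a₁ a₂ a₃ b (insert e F) z (Function.update τ e 1),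
    ← SwapRoots.typedCount_swap_roots ends o a₁ a₂ a₃ b F z τ]
  exact rootMonoO_of_b_path ends o a₂ a₁ a₃ b he hf hg F heF hfF hgF z hze τ hτ hτf hτg

/-- The mirror of `rootMonoB_of_o_path` at `a₂`. -/
theorem rootMonoB_of_o_path' {e f g : E} (he : ends e = s(a₂, b)) (hf : ends f = s(a₂, o))
    (hg : ends g = s(o, b)) (F : Finset E) (heF : e ∉ F) (hfF : f ∈ F) (hgF : g ∈ F)
    (z : Config E) (hze : z e = false) (τ : E → ℕ) (hτ : ∀ e' ∈ F, τ e' = 1 ∨ τ e' = 2)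
    (hτf : τ f = 2) (hτg : τ g = 2) :
    typedCount F z τ (K3 ends o a₁ a₂ a₃ b : Config E → Config E → Config E → R) ≤
      typedCount (insert e F) z (Function.update τ e 1) (K3 ends o a₁ a₂ a₃ b) := by
  rw [← SwapRoots.typedCount_swap_roots ends o a₁ a₂ a₃ b (insert e F) z (Function.update τ e 1),
    ← SwapRoots.typedCount_swap_roots ends o a₁ a₂ a₃ b F z τ]
  exact rootMonoB_of_o_path ends o a₂ a₁ a₃ b he hf hg F heF hfF hgF z hze τ hτ hτf hτg

end Mirrors

end Triangle

end CovForm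

end Summit.Ventures.PercRepro2
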